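import Literature.Computability.Complexity.GraphCanonizationProgramFPClassify
import HarnessLib

/-!
# The canoniser as a list program is typed polynomial time, VI: the machine transition

**`codeFP_stepL`** — one transition of the stack machine on lists (`CGProg.stepL`,
`GraphCanonizationProgramMachine.lean`) is typed polynomial time on `((1ⁿ, rows), configuration)`,
the configuration coded as the raw list of the codes of its frames (`CGProg.frameE`). The
transition is decomposed by the constructor of the top frame (`stepRetL`, `stepIndivL`,
`stepSectL`, `stepL_cons`), each branch a case analysis on a list or an option
(`CodeFP.rawCases`, `CodeFP.optCases`) assembling records of frames; the branch is selected by
the tag of the record of the top frame.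

## References

* S. Arora, B. Barak, *Computational Complexity: A Modern Approach*, CUP 2009, §1.3. [AroraBarakCC2009]
* B. Laubner, PhD thesis, HU Berlin 2011, doi:10.18452/16335, §3.4. [Laubner2011]
-/

namespace Literature.Computability.Complexity

open _root_.Computability CodeFP Polynomial CGCanon

namespace CGProg

variable (n : ℕ) (A : List (List Bool))

/-! ### The transition by the top frame -/

/-- Delivering a finished ordering to the frame below. [folklore] -/
def stepRetL (ord : List ℕ) : List LFrame → List LFrame
  | LFrame.indiv mask col (some x) xs best :: stk =>
      LFrame.indiv mask col none xs (bestOfL best (toLex (toLex (codeL A col ord), toLex (x, ord)))) :: stk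
  | LFrame.sect mask col (some K) todo done :: stk => LFrame.sect mask col none todo (done ++ [(K, ord)]) :: stk
  | stk => LFrame.ret ord :: stk

/-- An individualization frame on top. [folklore] -/
def stepIndivL (mask : List Bool) (col : List ℕ) (xs : List ℕ) (best : Option LCand) (stk : List LFrame) : List LFrame :=
  match xs with
  | x :: xs => classifyL n A mask (refineL n A mask (individualizeL col x)) :: LFrame.indiv mask col (some x) xs best :: stk
  | [] => LFrame.ret (best.elim [] fun b => (ofLex (ofLex b).2).2) :: stk

/-- A section frame on top. [folklore] -/
def stepSectL (mask : List Bool) (col : List ℕ) (todo : List (List Bool)) (done : List (List Bool × List ℕ))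
    (stk : List LFrame) : List LFrame :=
  match todo with
  | K :: todo => classifyL n A K col :: LFrame.sect mask col (some K) todo done :: stk
  | [] => LFrame.ret (pasteL A col done) :: stk

/-- `stepL` by the top frame. [folklore] -/
theorem stepL_cons (f : LFrame) (stk : List LFrame) : stepL n A (f :: stk) =
    match f with
    | LFrame.ret ord => stepRetL A ord stk
    | LFrame.indiv mask col _ xs best => stepIndivL n A mask col xs best stk
    | LFrame.sect mask col _ todo done => stepSectL n A mask col todo done stk := by
  rcases f with ⟨mask, col, cur, xs, best⟩ | ⟨mask, col, cur, todo, done⟩ | ord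
  · cases xs <;> cases cur <;> rfl
  · cases todo <;> cases cur <;> rfl
  · rcases stk with _ | ⟨g, stk⟩
    · rfl
    rcases g with ⟨m, c, cur, xs, b⟩ | ⟨m, c, cur, t, d⟩ | o
    · cases cur <;> rfl
    · cases cur <;> rfl
    · rfl

/-! ### Records of frames, general form -/

/-- The record of an individualization frame from computed fields (the candidate as data). [folklore] -/
theorem codeFP_indivRecord' {α : Type} {eα : α → List Bool} {m : α → List Bool} {c xs : α → List ℕ} {cur : α → Option ℕ}
    {best : α → Option LCandT} (hm : CodeFP eα strE m) (hc : CodeFP eα (rawE natE) c) (hcur : CodeFP eα (optE natE) cur)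
    (hxs : CodeFP eα (rawE natE) xs) (hb : CodeFP eα (optE candTE) best) :
    CodeFP eα frameE (fun a => LFrame.indiv (m a) (c a) (cur a) (xs a) ((best a).map candOfT)) := by
  have h : CodeFP eα ftupleE (fun a => ((0 : ℕ), m a, c a, cur a, xs a, best a,
      (none : Option (List Bool)), ([] : List (List Bool)), ([] : List (List Bool × List ℕ)), ([] : List ℕ))) :=
    (const _ 0).pair (hm.pair (hc.pair (hcur.pair (hxs.pair (hb.pair
      ((const _ none).pair ((const _ []).pair ((const _ []).pair (const _ [])))))))))
  exact h.recodeOut fun a => (frameE_indiv (m a) (c a) (cur a) (xs a) (best a)).symm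

/-- The record of a section frame from computed fields. [folklore] -/
theorem codeFP_sectRecord' {α : Type} {eα : α → List Bool} {m : α → List Bool} {c : α → List ℕ} {cur : α → Option (List Bool)}
    {todo : α → List (List Bool)} {done : α → List (List Bool × List ℕ)} (hm : CodeFP eα strE m) (hc : CodeFP eα (rawE natE) c)
    (hcur : CodeFP eα (optE strE) cur) (ht : CodeFP eα (rawE strE) todo) (hd : CodeFP eα (rawE (pairE strE (rawE natE))) done) :
    CodeFP eα frameE (fun a => LFrame.sect (m a) (c a) (cur a) (todo a) (done a)) := by
  have h : CodeFP eα ftupleE (fun a => ((1 : ℕ), m a, c a, (none : Option ℕ), ([] : List ℕ), (none : Option LCandT),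
      cur a, todo a, done a, ([] : List ℕ))) :=
    (const _ 1).pair (hm.pair (hc.pair ((const _ none).pair ((const _ []).pair ((const _ none).pair
      (hcur.pair (ht.pair (hd.pair (const _ [])))))))))
  exact h.recodeOut fun a => (frameE_sect (m a) (c a) (cur a) (todo a) (done a)).symm

/-- **Individualizing a vertex is typed polynomial time**: input `(colours, x)`. [cite: AroraBarakCC2009, §1.3] -/
theorem codeFP_individualizeL : CodeFP (pairE (rawE natE) natE) (rawE natE) (fun p => individualizeL p.1 p.2) := by
  let κ : (List ℕ × ℕ) × ℕ → List Bool := pairE (pairE (rawE natE) natE) natE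
  have hc : CodeFP κ (rawE natE) (fun t => t.1.1) := (fst _ _).fst'
  have hx : CodeFP κ natE (fun t => t.1.2) := (fst _ _).snd'
  have hw : CodeFP κ natE (fun t => t.2) := snd _ _
  have heq : CodeFP κ bitE (fun t => decide (t.2 = t.1.2)) := natEq.comp (hw.pair hx)
  have hsucc : CodeFP κ natE (fun t => natAt t.1.1 t.2 + 1) := (natAdd.comp ((codeFP_natAt.comp (hc.pair hw)).pair (const _ 1))).congr fun _ => rfl
  have hitem : CodeFP κ natE (fun t => if decide (t.2 = t.1.2) then 0 else natAt t.1.1 t.2 + 1) := heq.ite (const _ 0) hsucc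
  have hr : CodeFP (pairE (rawE natE) natE) (rawE natE) (fun p => List.range p.1.length) := urange.comp ((ulength natE).comp (fst _ _))
  exact ((map hitem).comp ((CodeFP.id _).pair hr)).congr fun p => by
    unfold individualizeL
    exact List.map_congr_left fun w _ => by simp only [decide_eq_true_eq]; rfl

/-! ### Certificates of the branches -/

/-- The context `(1ⁿ, rows)`. [folklore] -/
abbrev σE : ℕ × List (List Bool) → List Bool := pairE unE (rawE strE)

/-- The context `((1ⁿ, rows), (top frame, stack below))`. [folklore] -/
abbrev τE : (ℕ × List (List Bool)) × (LFrame × List LFrame) → List Bool := pairE σE (pairE frameE (rawE frameE))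

variable {n A}

/-- **Delivering to the frame below is typed polynomial time**: input `((1ⁿ, rows), (ord, stack))`. [cite: AroraBarakCC2009, §1.3] -/
theorem codeFP_stepRetL : CodeFP (pairE σE (pairE (rawE natE) (rawE frameE))) (rawE frameE) (fun p => stepRetL p.1.2 p.2.1 p.2.2) := by
  -- cons case: context `((n, A), ord)`, head frame `g`, stack `stk`
  let κ : ((ℕ × List (List Bool)) × List ℕ) × (LFrame × List LFrame) → List Bool :=
    pairE (pairE σE (rawE natE)) (pairE frameE (rawE frameE))
  have hA : CodeFP κ (rawE strE) (fun t => t.1.1.2) := (fst _ _).fst'.snd'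
  have hord : CodeFP κ (rawE natE) (fun t => t.1.2) := (fst _ _).snd'
  have hg : CodeFP κ ftupleE (fun t => tupleOf t.2.1) := codeFP_tupleOf.comp (snd _ _).fst'
  have hstk : CodeFP κ (rawE frameE) (fun t => t.2.2) := (snd _ _).snd'
  have htag : CodeFP κ natE (fun t => (tupleOf t.2.1).1) := hg.fst'
  have hmask : CodeFP κ strE (fun t => (tupleOf t.2.1).2.1) := hg.snd'.fst'
  have hcol : CodeFP κ (rawE natE) (fun t => (tupleOf t.2.1).2.2.1) := hg.snd'.snd'.fst'
  have hcur : CodeFP κ (optE natE) (fun t => (tupleOf t.2.1).2.2.2.1) := hg.snd'.snd'.snd'.fst'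
  have hxs : CodeFP κ (rawE natE) (fun t => (tupleOf t.2.1).2.2.2.2.1) := hg.snd'.snd'.snd'.snd'.fst'
  have hbest : CodeFP κ (optE candTE) (fun t => (tupleOf t.2.1).2.2.2.2.2.1) := hg.snd'.snd'.snd'.snd'.snd'.fst'
  have hcurK : CodeFP κ (optE strE) (fun t => (tupleOf t.2.1).2.2.2.2.2.2.1) := hg.snd'.snd'.snd'.snd'.snd'.snd'.fst'
  have htodo : CodeFP κ (rawE strE) (fun t => (tupleOf t.2.1).2.2.2.2.2.2.2.1) := hg.snd'.snd'.snd'.snd'.snd'.snd'.snd'.fst'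
  have hdone : CodeFP κ (rawE (pairE strE (rawE natE))) (fun t => (tupleOf t.2.1).2.2.2.2.2.2.2.2.1) :=
    hg.snd'.snd'.snd'.snd'.snd'.snd'.snd'.snd'.fst'
  -- branch 1: the updated individualization frame
  have hx : CodeFP κ natE (fun t => ((tupleOf t.2.1).2.2.2.1).getD 0) := (optGetD natE).comp (hcur.pair (const _ 0))
  have hcd : CodeFP κ codeTE (fun t => codeL t.1.1.2 (tupleOf t.2.1).2.2.1 t.1.2) := (codeFP_codeL.comp ((hA.pair hcol).pair hord)).congr fun _ => rfl
  have hcand : CodeFP κ candTE (fun t => (codeL t.1.1.2 (tupleOf t.2.1).2.2.1 t.1.2, (((tupleOf t.2.1).2.2.2.1).getD 0, t.1.2))) :=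
    hcd.pair (hx.pair hord)
  have hbest' : CodeFP κ (optE candTE) (fun t => bestOfT (tupleOf t.2.1).2.2.2.2.2.1
      (codeL t.1.1.2 (tupleOf t.2.1).2.2.1 t.1.2, (((tupleOf t.2.1).2.2.2.1).getD 0, t.1.2))) :=
    (codeFP_bestOfT.comp (hbest.pair hcand)).congr fun _ => rfl
  have hF1 : CodeFP κ (rawE frameE) (fun t => LFrame.indiv (tupleOf t.2.1).2.1 (tupleOf t.2.1).2.2.1 none (tupleOf t.2.1).2.2.2.2.1
      ((bestOfT (tupleOf t.2.1).2.2.2.2.2.1 (codeL t.1.1.2 (tupleOf t.2.1).2.2.1 t.1.2, (((tupleOf t.2.1).2.2.2.1).getD 0, t.1.2))).map candOfT)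
        :: t.2.2) :=
    ((rawCons _).comp ((codeFP_indivRecord' hmask hcol (const _ none) hxs hbest').pair hstk)).congr fun _ => rfl
  -- branch 2: the updated section frame
  have hK : CodeFP κ strE (fun t => ((tupleOf t.2.1).2.2.2.2.2.2.1).getD []) := (optGetD strE).comp (hcurK.pair (const _ []))
  have hdone' : CodeFP κ (rawE (pairE strE (rawE natE))) (fun t => (tupleOf t.2.1).2.2.2.2.2.2.2.2.1 ++ [(((tupleOf t.2.1).2.2.2.2.2.2.1).getD [], t.1.2)]) :=
    ((rawAppend _).comp (hdone.pair ((rawSingleton _).comp (hK.pair hord)))).congr fun _ => rfl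
  have hF2 : CodeFP κ (rawE frameE) (fun t => LFrame.sect (tupleOf t.2.1).2.1 (tupleOf t.2.1).2.2.1 none (tupleOf t.2.1).2.2.2.2.2.2.2.1
      ((tupleOf t.2.1).2.2.2.2.2.2.2.2.1 ++ [(((tupleOf t.2.1).2.2.2.2.2.2.1).getD [], t.1.2)]) :: t.2.2) :=
    ((rawCons _).comp ((codeFP_sectRecord' hmask hcol (const _ none) htodo hdone').pair hstk)).congr fun _ => rfl
  -- branch 3: unchanged
  have hF3 : CodeFP κ (rawE frameE) (fun t => LFrame.ret t.1.2 :: t.2.1 :: t.2.2) :=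
    ((rawCons _).comp ((codeFP_retRecord hord).pair ((rawCons _).comp (snd _ _)))).congr fun _ => rfl
  have hc1 : CodeFP κ bitE (fun t => decide ((tupleOf t.2.1).1 = 0) && ((tupleOf t.2.1).2.2.2.1).isSome) :=
    ((natEq.comp (htag.pair (const _ 0))).and ((optIsSome natE).comp hcur)).congr fun _ => rfl
  have hc2 : CodeFP κ bitE (fun t => decide ((tupleOf t.2.1).1 = 1) && ((tupleOf t.2.1).2.2.2.2.2.2.1).isSome) :=
    ((natEq.comp (htag.pair (const _ 1))).and ((optIsSome strE).comp hcurK)).congr fun _ => rfl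
  have hG := hc1.ite hF1 (hc2.ite hF2 hF3)
  have hnil : CodeFP (pairE σE (rawE natE)) (rawE frameE) (fun s => [LFrame.ret s.2]) :=
    ((rawSingleton _).comp (codeFP_retRecord (snd _ _))).congr fun _ => rfl
  have h := rawCases (eσ := pairE σE (rawE natE)) (eα := frameE) (eδ := rawE frameE) (k := fun s stk => stepRetL s.1.2 s.2 stk) hnil hG
    (fun _ => rfl) (fun s g stk => by
      rcases g with ⟨mask, col, cur, xs, best⟩ | ⟨mask, col, cur, todo, done⟩ | o
      · cases cur
        · rfl
        · dsimp only
          rw [if_pos (by rfl)]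
          simp only [stepRetL, tupleOf, Option.getD_some]
          congr 2
          rw [show ((codeL s.1.2 col s.2, _, s.2) : LCandT) = dataOfCand (toLex (toLex (codeL s.1.2 col s.2), toLex (_, s.2))) from rfl,
            bestOfT_eq, Option.map_map, show candOfT ∘ dataOfCand = id from funext candOfT_dataOfCand, Option.map_id]
          rfl
      · cases cur
        · rfl
        · dsimp only
          rw [if_neg (by simp [tupleOf]), if_pos (by rfl)]
          rfl
      · rfl)
  exact (h.comp (((fst _ _).pair (snd _ _).fst').pair (snd _ _).snd')).congr fun _ => rfl

/-- Reading the fields of the top frame. [folklore] -/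
theorem codeFP_topTuple : CodeFP τE ftupleE (fun t => tupleOf t.2.1) := codeFP_tupleOf.comp (snd _ _).fst'

/-- **An individualization frame on top is typed polynomial time** (fields read off the record of the top frame). [cite: AroraBarakCC2009, §1.3] -/
theorem codeFP_stepIndivL : CodeFP τE (rawE frameE) (fun t => stepIndivL t.1.1 t.1.2 (tupleOf t.2.1).2.1 (tupleOf t.2.1).2.2.1
    (tupleOf t.2.1).2.2.2.2.1 (((tupleOf t.2.1).2.2.2.2.2.1).map candOfT) t.2.2) := by
  have hg := codeFP_topTuple
  have hmask : CodeFP τE strE (fun t => (tupleOf t.2.1).2.1) := hg.snd'.fst'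
  have hcol : CodeFP τE (rawE natE) (fun t => (tupleOf t.2.1).2.2.1) := hg.snd'.snd'.fst'
  have hxs : CodeFP τE (rawE natE) (fun t => (tupleOf t.2.1).2.2.2.2.1) := hg.snd'.snd'.snd'.snd'.fst'
  have hbest : CodeFP τE (optE candTE) (fun t => (tupleOf t.2.1).2.2.2.2.2.1) := hg.snd'.snd'.snd'.snd'.snd'.fst'
  have hstk : CodeFP τE (rawE frameE) (fun t => t.2.2) := (snd _ _).snd'
  -- no vertex left: return the ordering of the least candidate
  have hord : CodeFP τE (rawE natE) (fun t => (((tupleOf t.2.1).2.2.2.2.2.1).map candOfT).elim [] fun b => (ofLex (ofLex b).2).2) := by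
    have h := optCases (eσ := τE) (eα := candTE) (eδ := rawE natE) (k := fun _ o => (o.map candOfT).elim [] fun b => (ofLex (ofLex b).2).2)
      (gnone := fun _ => []) (gsome := fun q => q.2.2.2) (const _ []) (snd _ _).snd'.snd' (fun _ => rfl) (fun _ _ => rfl)
    exact (h.comp ((CodeFP.id _).pair hbest)).congr fun _ => rfl
  have hnil : CodeFP τE (rawE frameE) (fun t => LFrame.ret ((((tupleOf t.2.1).2.2.2.2.2.1).map candOfT).elim [] fun b => (ofLex (ofLex b).2).2) :: t.2.2) :=
    ((rawCons _).comp ((codeFP_retRecord hord).pair hstk)).congr fun _ => rfl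
  -- a vertex `x` to do: context `t`, head `x`, tail `xs'`
  let κ : ((ℕ × List (List Bool)) × (LFrame × List LFrame)) × (ℕ × List ℕ) → List Bool := pairE τE (pairE natE (rawE natE))
  have kt : CodeFP κ τE (fun q => q.1) := fst _ _
  have kx : CodeFP κ natE (fun q => q.2.1) := (snd _ _).fst'
  have kxs : CodeFP κ (rawE natE) (fun q => q.2.2) := (snd _ _).snd'
  have kind : CodeFP κ (rawE natE) (fun q => individualizeL (tupleOf q.1.2.1).2.2.1 q.2.1) :=
    (codeFP_individualizeL.comp ((hcol.comp kt).pair kx)).congr fun _ => rfl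
  have kref : CodeFP κ (rawE natE) (fun q => refineL q.1.1.1 q.1.1.2 (tupleOf q.1.2.1).2.1 (individualizeL (tupleOf q.1.2.1).2.2.1 q.2.1)) :=
    (codeFP_refineL.comp ((((fst _ _).fst'.comp kt).pair (((fst _ _).snd'.comp kt).pair (hmask.comp kt))).pair kind)).congr fun _ => rfl
  have kcls : CodeFP κ frameE (fun q => classifyL q.1.1.1 q.1.1.2 (tupleOf q.1.2.1).2.1
      (refineL q.1.1.1 q.1.1.2 (tupleOf q.1.2.1).2.1 (individualizeL (tupleOf q.1.2.1).2.2.1 q.2.1))) :=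
    (codeFP_classifyL.comp (((fst _ _).comp kt).pair ((hmask.comp kt).pair kref))).congr fun _ => rfl
  have kfr : CodeFP κ frameE (fun q => LFrame.indiv (tupleOf q.1.2.1).2.1 (tupleOf q.1.2.1).2.2.1 (some q.2.1) q.2.2 (((tupleOf q.1.2.1).2.2.2.2.2.1).map candOfT)) :=
    (codeFP_indivRecord' (hmask.comp kt) (hcol.comp kt) ((optSome natE).comp kx) kxs (hbest.comp kt)).congr fun _ => rfl
  have hcons : CodeFP κ (rawE frameE) (fun q => classifyL q.1.1.1 q.1.1.2 (tupleOf q.1.2.1).2.1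
      (refineL q.1.1.1 q.1.1.2 (tupleOf q.1.2.1).2.1 (individualizeL (tupleOf q.1.2.1).2.2.1 q.2.1)) ::
      LFrame.indiv (tupleOf q.1.2.1).2.1 (tupleOf q.1.2.1).2.2.1 (some q.2.1) q.2.2 (((tupleOf q.1.2.1).2.2.2.2.2.1).map candOfT) :: q.1.2.2) :=
    ((rawCons _).comp (kcls.pair ((rawCons _).comp (kfr.pair (hstk.comp kt))))).congr fun _ => rfl
  have h := rawCases (eσ := τE) (eα := natE) (eδ := rawE frameE)
    (k := fun t xs => stepIndivL t.1.1 t.1.2 (tupleOf t.2.1).2.1 (tupleOf t.2.1).2.2.1 xs (((tupleOf t.2.1).2.2.2.2.2.1).map candOfT) t.2.2)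
    hnil hcons (fun _ => rfl) (fun _ _ _ => rfl)
  exact (h.comp ((CodeFP.id _).pair hxs)).congr fun _ => rfl

/-- **A section frame on top is typed polynomial time** (fields read off the record of the top frame). [cite: AroraBarakCC2009, §1.3] -/
theorem codeFP_stepSectL : CodeFP τE (rawE frameE) (fun t => stepSectL t.1.1 t.1.2 (tupleOf t.2.1).2.1 (tupleOf t.2.1).2.2.1
    (tupleOf t.2.1).2.2.2.2.2.2.2.1 (tupleOf t.2.1).2.2.2.2.2.2.2.2.1 t.2.2) := by
  have hg := codeFP_topTuple
  have hA : CodeFP τE (rawE strE) (fun t => t.1.2) := (fst _ _).snd'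
  have hmask : CodeFP τE strE (fun t => (tupleOf t.2.1).2.1) := hg.snd'.fst'
  have hcol : CodeFP τE (rawE natE) (fun t => (tupleOf t.2.1).2.2.1) := hg.snd'.snd'.fst'
  have htodo : CodeFP τE (rawE strE) (fun t => (tupleOf t.2.1).2.2.2.2.2.2.2.1) := hg.snd'.snd'.snd'.snd'.snd'.snd'.snd'.fst'
  have hdone : CodeFP τE (rawE (pairE strE (rawE natE))) (fun t => (tupleOf t.2.1).2.2.2.2.2.2.2.2.1) :=
    hg.snd'.snd'.snd'.snd'.snd'.snd'.snd'.snd'.fst'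
  have hstk : CodeFP τE (rawE frameE) (fun t => t.2.2) := (snd _ _).snd'
  -- no part left: paste
  have hpaste : CodeFP τE (rawE natE) (fun t => pasteL t.1.2 (tupleOf t.2.1).2.2.1 (tupleOf t.2.1).2.2.2.2.2.2.2.2.1) :=
    (codeFP_pasteL.comp ((hA.pair hcol).pair hdone)).congr fun _ => rfl
  have hnil : CodeFP τE (rawE frameE) (fun t => LFrame.ret (pasteL t.1.2 (tupleOf t.2.1).2.2.1 (tupleOf t.2.1).2.2.2.2.2.2.2.2.1) :: t.2.2) :=
    ((rawCons _).comp ((codeFP_retRecord hpaste).pair hstk)).congr fun _ => rfl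
  -- a part `K` to do
  let κ : ((ℕ × List (List Bool)) × (LFrame × List LFrame)) × (List Bool × List (List Bool)) → List Bool := pairE τE (pairE strE (rawE strE))
  have kt : CodeFP κ τE (fun q => q.1) := fst _ _
  have kK : CodeFP κ strE (fun q => q.2.1) := (snd _ _).fst'
  have ktodo : CodeFP κ (rawE strE) (fun q => q.2.2) := (snd _ _).snd'
  have kcls : CodeFP κ frameE (fun q => classifyL q.1.1.1 q.1.1.2 q.2.1 (tupleOf q.1.2.1).2.2.1) :=
    (codeFP_classifyL.comp (((fst _ _).comp kt).pair (kK.pair (hcol.comp kt)))).congr fun _ => rfl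
  have kfr : CodeFP κ frameE (fun q => LFrame.sect (tupleOf q.1.2.1).2.1 (tupleOf q.1.2.1).2.2.1 (some q.2.1) q.2.2 (tupleOf q.1.2.1).2.2.2.2.2.2.2.2.1) :=
    (codeFP_sectRecord' (hmask.comp kt) (hcol.comp kt) ((optSome strE).comp kK) ktodo (hdone.comp kt)).congr fun _ => rfl
  have hcons : CodeFP κ (rawE frameE) (fun q => classifyL q.1.1.1 q.1.1.2 q.2.1 (tupleOf q.1.2.1).2.2.1 ::
      LFrame.sect (tupleOf q.1.2.1).2.1 (tupleOf q.1.2.1).2.2.1 (some q.2.1) q.2.2 (tupleOf q.1.2.1).2.2.2.2.2.2.2.2.1 :: q.1.2.2) :=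
    ((rawCons _).comp (kcls.pair ((rawCons _).comp (kfr.pair (hstk.comp kt))))).congr fun _ => rfl
  have h := rawCases (eσ := τE) (eα := strE) (eδ := rawE frameE)
    (k := fun t todo => stepSectL t.1.1 t.1.2 (tupleOf t.2.1).2.1 (tupleOf t.2.1).2.2.1 todo (tupleOf t.2.1).2.2.2.2.2.2.2.2.1 t.2.2)
    hnil hcons (fun _ => rfl) (fun _ _ _ => rfl)
  exact (h.comp ((CodeFP.id _).pair htodo)).congr fun _ => rfl

/-- **One transition of the list machine is typed polynomial time**: input `((1ⁿ, rows), configuration)`.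
[cite: AroraBarakCC2009, §1.3] -/
theorem codeFP_stepL : CodeFP (pairE σE (rawE frameE)) (rawE frameE) (fun p => stepL p.1.1 p.1.2 p.2) := by
  have htag : CodeFP τE natE (fun t => (tupleOf t.2.1).1) := codeFP_topTuple.fst'
  have hord : CodeFP τE (rawE natE) (fun t => (tupleOf t.2.1).2.2.2.2.2.2.2.2.2) := codeFP_topTuple.snd'.snd'.snd'.snd'.snd'.snd'.snd'.snd'.snd'
  have hret : CodeFP τE (rawE frameE) (fun t => stepRetL t.1.2 (tupleOf t.2.1).2.2.2.2.2.2.2.2.2 t.2.2) :=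
    (codeFP_stepRetL.comp ((fst _ _).pair (hord.pair (snd _ _).snd'))).congr fun _ => rfl
  have h2 : CodeFP τE bitE (fun t => decide ((tupleOf t.2.1).1 = 2)) := natEq.comp (htag.pair (const _ 2))
  have h0 : CodeFP τE bitE (fun t => decide ((tupleOf t.2.1).1 = 0)) := natEq.comp (htag.pair (const _ 0))
  have hG := h2.ite hret (h0.ite codeFP_stepIndivL codeFP_stepSectL)
  have h := rawCases (eσ := σE) (eα := frameE) (eδ := rawE frameE) (k := fun s cfg => stepL s.1 s.2 cfg) (gnil := fun _ => []) (const _ []) hG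
    (fun _ => rfl) (fun s f stk => by
      rw [stepL_cons]
      rcases f with ⟨mask, col, cur, xs, best⟩ | ⟨mask, col, cur, todo, done⟩ | o
      · dsimp only
        rw [if_neg (by simp [tupleOf]), if_pos (by rfl)]
        simp [tupleOf, Option.map_map, show candOfT ∘ dataOfCand = id from funext candOfT_dataOfCand]
      · dsimp only
        rw [if_neg (by simp [tupleOf]), if_neg (by simp [tupleOf])]
        rfl
      · dsimp only
        rw [if_pos (by rfl)]
        rfl)
  exact (h.comp ((fst _ _).pair (snd _ _))).congr fun _ => rfl

end CGProg

end Literature.Computability.Complexity
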